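import Summits.Ventures.PercRepro.SixFourPLPlanes

/-!
# PercRepro — C-025 at `(6,4)`, §22.12.2 (b): the lines of a plane-line set (p3, gen 9)

mine-2's `MINE2-RLS.md` 22.12.2 (b): for a normalisation `D : PLData M G`, a line `L′` of `M` with at least `3`
points of `G` is either `ℓ = cl(L)` or a line of `ρ` (its trace lies in `ρ`):
* two points of `L` on `L′` force `L′ = ℓ` (`line_eq_ellF_of_two_mem_L`);
* one point `x ∈ L` with two points of `ρ` would put `x ∈ cl(ρ) = P₀` (`not_line_through_L_and_two_of_ρ`);
* so a line with `≥ 3` points of `G` and `≤ 1` point of `L` has all its points of `G` in `ρ` (`line_trichotomy`).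
The other lines of `M` meeting `G` in exactly two points — `n·(p − e)` of them across `ρ` and `L` — carry
`bonus(2) = 0`; the three kinds give the line counts `b_m(π)` of 22.12.4.
-/

namespace PercRepro.SixFour

open Finset ThmH

variable {α : Type*} [DecidableEq α] {M : Matroid α} [M.Finite] {G : Finset α}

namespace PLData

variable {D : PLData M G}

/-- A line of `M` through two points of `L` is `ℓ`. -/
theorem line_eq_ellF_of_two_mem_L (hs : Simple M) (hG : G ⊆ gr M) {L' : Finset α} (hL' : L' ∈ lines M)
    {a b : α} (ha : a ∈ L' ∩ D.L) (hb : b ∈ L' ∩ D.L) (hab : a ≠ b) : L' = D.ellF := by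
  rw [Finset.mem_inter] at ha hb
  apply Finset.coe_injective
  unfold ellF
  rw [coe_clF, ← closure_pair_eq_of_eRk_le_two hs (D.L_subset.trans hG) D.rank_rest ha.2 hb.2 hab]
  have hsub : ({a, b} : Finset α) ⊆ L' := by
    intro z hz
    rw [Finset.mem_insert, Finset.mem_singleton] at hz
    rcases hz with rfl | rfl
    · exact ha.1
    · exact hb.1
  have h2 : M.eRk (({a, b} : Finset α) : Set α) = 2 :=
    eRk_eq_two_of_subset_line hs hL' hsub (by rw [Finset.card_pair hab])
  exact (closure_eq_of_subset_line hL' hsub h2).symm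

/-- No line of `M` contains a point of `L` and two points of `ρ` (it would lie in `P₀`). -/
theorem not_line_through_L_and_two_of_ρ (hs : Simple M) {L' : Finset α} (hL' : L' ∈ lines M)
    {x a b : α} (hx : x ∈ L' ∩ D.L) (ha : a ∈ L' ∩ D.ρ) (hb : b ∈ L' ∩ D.ρ) (hab : a ≠ b) : False := by
  rw [Finset.mem_inter] at hx ha hb
  have hsub : ({a, b} : Finset α) ⊆ L' := by
    intro z hz
    rw [Finset.mem_insert, Finset.mem_singleton] at hz
    rcases hz with rfl | rfl
    · exact ha.1
    · exact hb.1
  have h2 : M.eRk (({a, b} : Finset α) : Set α) = 2 :=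
    eRk_eq_two_of_subset_line hs hL' hsub (by rw [Finset.card_pair hab])
  have hcl := closure_eq_of_subset_line hL' hsub h2
  -- `L' = cl{a, b} ⊆ P₀`
  have hL'P₀ : (L' : Set α) ⊆ (D.P₀ : Set α) := by
    rw [← hcl]
    calc M.closure (({a, b} : Finset α) : Set α) ⊆ M.closure (D.P₀ : Set α) := by
          apply M.closure_subset_closure
          intro z hz
          rw [Finset.mem_coe, Finset.mem_insert, Finset.mem_singleton] at hz
          rcases hz with rfl | rfl
          · exact (Finset.mem_inter.1 ha.2).1
          · exact (Finset.mem_inter.1 hb.2).1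
      _ = (D.P₀ : Set α) := (mem_planes.1 D.plane).2.1.closure
  have hxP₀ : x ∈ D.P₀ := hL'P₀ hx.1
  unfold L at hx
  exact (Finset.mem_sdiff.1 hx.2).2 hxP₀

/-- **The lines with `≥ 3` points of `G` (22.12.2 (b))**: such a line is `ℓ`, or all its points of `G` lie in `ρ`. -/
theorem line_trichotomy (hs : Simple M) (hG : G ⊆ gr M) {L' : Finset α} (hL' : L' ∈ lines M)
    (h3 : 3 ≤ (L' ∩ G).card) : L' = D.ellF ∨ L' ∩ G ⊆ D.ρ := by
  by_cases h2 : 2 ≤ (L' ∩ D.L).card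
  · obtain ⟨a, ha, b, hb, hab⟩ := Finset.one_lt_card.1 h2
    exact Or.inl (line_eq_ellF_of_two_mem_L hs hG hL' ha hb hab)
  · right
    push Not at h2
    intro z hz
    rw [Finset.mem_inter] at hz
    by_contra hzρ
    have hzL : z ∈ L' ∩ D.L := by
      rw [Finset.mem_inter]
      refine ⟨hz.1, Finset.mem_sdiff.2 ⟨hz.2, fun hzP => hzρ ?_⟩⟩
      unfold ρ
      exact Finset.mem_inter.2 ⟨hzP, hz.2⟩
    -- the other points of `L' ∩ G` lie in `ρ` (at most one point of `L`), and there are at least two of them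
    have hsub : (L' ∩ G).erase z ⊆ L' ∩ D.ρ := by
      intro w hw
      rw [Finset.mem_erase, Finset.mem_inter] at hw
      rw [Finset.mem_inter]
      refine ⟨hw.2.1, ?_⟩
      by_contra hwρ
      have hwL : w ∈ L' ∩ D.L := by
        rw [Finset.mem_inter]
        refine ⟨hw.2.1, Finset.mem_sdiff.2 ⟨hw.2.2, fun hwP => hwρ ?_⟩⟩
        unfold ρ
        exact Finset.mem_inter.2 ⟨hwP, hw.2.2⟩
      have : 2 ≤ (L' ∩ D.L).card :=
        Finset.one_lt_card.2 ⟨z, hzL, w, hwL, fun h => hw.1 h.symm⟩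
      omega
    have hc : 2 ≤ (L' ∩ D.ρ).card := by
      have := Finset.card_le_card hsub
      rw [Finset.card_erase_of_mem (Finset.mem_inter.2 hz)] at this
      omega
    obtain ⟨a, ha, b, hb, hab⟩ := Finset.one_lt_card.1 hc
    exact not_line_through_L_and_two_of_ρ hs hL' hzL ha hb hab

end PLData

end PercRepro.SixFour
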